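import Summits.MatrixMultiplication.MatrixMultiplication.Theorems.EdgePencilSixthAlpha
import Summits.MatrixMultiplication.MatrixMultiplication.Theorems.EdgePencilPlusTwoCut
import HarnessLib

/-!
# The price of a rung: what `χ(δ) ≤ ω(2,1,2)` is worth toward `ω = 2`, given the residual

Helper kernel for `stmt-MatrixMultiplication-26697` (`TetraExcessZero : ω(K₄) ≤ ω(2,1,2)`, the attacked
leaf of route `TetrahedronCarving`; cut of record `closes (hA : TetraExcessZero) (hB : TetraPlusTwo) :
ω = 2`, UNCHANGED; lineage `decomp-mm-lens-6` «barrier-complement carving», generation 38). No item is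
added or changed. Notation as in `EdgePencilSixthLadder` / `EdgePencilSixthAlpha`: `χ = omegaSix`, the
sixth-edge ladder (`χ(0) = ψ = ω(2,1,2)`, `χ(1) = T = ω(K₄)`), a RUNG at `δ` is `χ(δ) ≤ ψ`, `α(K₄) =
tetraAlpha` is the top of the flat part (`sixRung_iff_le_tetraAlpha`), the leaf is the rung at `δ = 1`
(`α(K₄) = 1`), `B_c : 4 + c(ω − 2) ≤ ω(K₄)` is the residual pencil (`B_1 = TetraPlusTwo`), and
`κ(a) = (1 − 2a)/(1 − a)` is the chord slope of the defect cone (`rectDefect_le_kappa_mul_defect`: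
`ψ − 4 ≤ κ(a)(ω − 2)` for `a ≤ min(α, 1/2)`; `κ < 0.792` from Coppersmith's `α > 0.1722`, PROVED in the
tree, `κ < 0.5267` on the printed `α ≥ 0.3213`).

THE QUESTION (asked by the steward's hold: «what would partial progress on 26697 buy?»): the registered
line `rung_and_chord` attacks the leaf through rungs `χ(δ) ≤ ψ`, `δ > 0`; the cut of record consumes the
FULL leaf `δ = 1`. What is a rung at `δ < 1` worth toward the summit once the residual is in hand?

* §1 THE PRICE (every field). A rung at `δ`, a residual notch `B_c` and the chord at `a` give
  `((5+δ)c − 6κ(a))·(ω − 2) ≤ 4(1 − δ)` (`rungPrice_symm`, via the symmetrisation law `(5+δ)T ≤ 6χ(δ)`)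
  and `(c − κ(a))·(ω − 2) ≤ 1 − δ` (`rungPrice_linear`, via the padding `T ≤ χ(δ) + 1 − δ`); both vanish
  at `δ = 1` — the cut of record (`omega_eq_two_of_excessZero_of_plusTwo'`) is their endpoint. On the
  tree floor (`κ < 0.792`): `(0.248 + δ)(ω − 2) ≤ 4(1 − δ)` for `B_1`; on the record (`κ < 0.5267`):
  `(1.8398 + δ)(ω − 2) ≤ 4(1 − δ)`.
* §2 BY NAME over `ℂ`: `TetraPlusTwo → a ≤ α(K₄) → (0.248 + a)(ω − 2) ≤ 4(1 − a)`
  (`omega_price_of_le_tetraAlpha`), the stability form `1 − ε ≤ α(K₄) → (1.248 − ε)(ω − 2) ≤ 4ε`, the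
  quantitative converse `TetraPlusTwo → α(K₄) ≤ 1 − 0.208(ω − 2)`, and the NEWS THRESHOLD on the record: a
  rung at `δ ≥ 0.76` plus the residual beats the printed `ω ≤ 2.371552` (`omega_lt_of_rung_record`).
* §3 THE PRICE IS EXACT in the recorded web (`SixWorld`, `EdgePencilSixthConvexityWeb`): the
  SYMMETRISATION-TIGHT WORLDS `symmWorld d` — `ω = 2 + d`, `ψ = 4 + 0.5267d`, `T = ω + 2`,
  `χ(δ) = max(ψ, (5+δ)T/6)` — satisfy all six laws, the record chord and the residual `B_1` with EQUALITY,
  have flat part exactly `[0, a]` with `(1.8398 + a)d = 4(1 − a)`, and for `d ≤ 0.371552` also obey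
  `ψ ≥ 5ω/3`, `ω ≤ ω(1,1/2,1) + 1/2`, `ω ≤ 2.371552`, `T ≤ 4.633908`. Hence
  (`rung_and_residual_not_a_cut`): **for every `a < 1` there is a law-consistent world with the rung at
  `a`, the residual `TetraPlusTwo`, and `ω > 2`** — no rung short of the leaf closes the cut, and the
  price `4(1 − a)/(1.8398 + a)` of §1 is attained (`rungPrice_exact`); at `a = 0.7586` that world sits AT
  the printed record (`rung_below_threshold_no_news`). (The tree's `sixRungPos_undecided` has a rung
  without the residual: its hinge world violates `B_1`.)

Reading for the hold (memo NODE-g38): partial progress on the leaf is convertible into an `ω`-bound only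
above `δ ≈ 0.76` and only linearly (`ω − 2 ≲ 1.41·(1 − δ)` near the top on the record chord, `≲ 3.21·(1 − δ)`
on the floor); the IDEA-NEEDED tag on 26697 is thus a statement about the LAST quarter of the ladder,
where every cover certificate is already excluded (`EdgePencilCoverCeiling.weightedCover_ceiling`: a
cover-certified rung at `δ` forces `ω ≤ 3ψ/(5+δ)`, i.e. `ω < 2.13` at `δ = 0.76`).

References: Christandl–Vrana–Zuiddam, arXiv:1609.07476, §1.2–1.3, §2.1 (graph tensors, `ω(K₄)`,
non-uniform symmetrisation) [ChristandlVranaZuiddam2016]; Lotti–Romani 1983, §2–§3 (convexity, the chord)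
[LottiRomani1983]; Coppersmith 1982, Thm. 1 (`α > 0.17227`) [Coppersmith1982]; Vassilevska Williams–Xu–Xu–Zhou
2024, Thm. 1.2 (`ω ≤ 2.371552`, `α ≥ 0.321334`) [VassilevskaWilliamsXuXuZhou2024]; Brand et al. 2026,
Thm. 48 (`ω(K₄) < 4.633908`) [BrandEtAl2026]. Sorry-free; no new axiom, no instance, no notation, no
`Prop`-valued definition; linear / quadratic real arithmetic on recorded exponents.
-/

noncomputable section
set_option linter.dupNamespace false

open Literature.Computability.AlgebraicComplexity
open Summit.MatrixMultiplication.MatrixMultiplication.Theorems.TetrahedronTensor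
open Summit.MatrixMultiplication.MatrixMultiplication.Theses.TetrahedronCarving

namespace Summit.MatrixMultiplication.MatrixMultiplication.Theorems.EdgePencil

/-! ## §1 The price of a rung, every field -/

section Price
variable (F : Type) [Field F]

/-- **THE PRICE OF A RUNG, symmetrised form.** A rung `χ(δ) ≤ ω(2,1,2)` (`0 ≤ δ ≤ 1`), a residual notch
`B_c : 4 + c(ω − 2) ≤ ω(K₄)` and the chord face at `0 ≤ a ≤ 1/2`, `a ≤ α` give
`((5+δ)c − 6κ(a))·(ω − 2) ≤ 4(1 − δ)`, `κ(a) = (1−2a)/(1−a)`: from `(5+δ)·ω(K₄) ≤ 6·χ(δ) ≤ 6·ω(2,1,2)`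
and `ω(2,1,2) − 4 ≤ κ(a)(ω − 2)`. At `δ = 1`, `c = 1`, `a > 0` it is the cut of record.
[cite: ChristandlVranaZuiddam2016, §2.1 (nonuniformsymm)] [cite: LottiRomani1983, §3] -/
theorem rungPrice_symm {δ c a : ℝ} (hδ0 : 0 ≤ δ) (hδ1 : δ ≤ 1) (hr : omegaSix F δ ≤ omegaRect F 2 1 2)
    (hB : 4 + c * (omega F - 2) ≤ omegaTetra F) (ha0 : 0 ≤ a) (ha : a ≤ 1 / 2)
    (hα : a ≤ dualExponentAlpha F) :
    ((5 + δ) * c - 6 * ((1 - 2 * a) / (1 - a))) * (omega F - 2) ≤ 4 * (1 - δ) := by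
  have hT : omegaTetra F * (5 + δ) ≤ 6 * omegaRect F 2 1 2 := by
    have h := omegaTetra_le_of_sixRung_symm F hδ0 hδ1 hr
    rwa [le_div_iff₀ (by linarith : (0 : ℝ) < 5 + δ)] at h
  have hρ := rectDefect_le_kappa_mul_defect F ha0 ha hα
  have h1 : (5 + δ) * (4 + c * (omega F - 2)) ≤ (5 + δ) * omegaTetra F :=
    mul_le_mul_of_nonneg_left hB (by linarith)
  set κ := (1 - 2 * a) / (1 - a)
  linarith

/-- **THE PRICE OF A RUNG, linear form**: a rung at `δ ≤ 1`, `B_c` and the chord at `a` give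
`(c − κ(a))·(ω − 2) ≤ 1 − δ` (from the padding `ω(K₄) ≤ χ(δ) + 1 − δ`); for `c = 1` it beats the
symmetrised form only for `δ < 2κ − 1` (`< 0.0534` on the record chord, `< 0.584` on the floor).
[cite: ChristandlVranaZuiddam2016, Prop. 1.1.26] [cite: LottiRomani1983, §3] -/
theorem rungPrice_linear {δ c a : ℝ} (hδ1 : δ ≤ 1) (hr : omegaSix F δ ≤ omegaRect F 2 1 2)
    (hB : 4 + c * (omega F - 2) ≤ omegaTetra F) (ha0 : 0 ≤ a) (ha : a ≤ 1 / 2)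
    (hα : a ≤ dualExponentAlpha F) :
    (c - (1 - 2 * a) / (1 - a)) * (omega F - 2) ≤ 1 - δ := by
  have hT := omegaTetra_le_of_sixRung F hδ1 hr
  have hρ := rectDefect_le_kappa_mul_defect F ha0 ha hα
  set κ := (1 - 2 * a) / (1 - a)
  linarith

/-- The symmetrised price at the top of the flat part `δ = α(K₄)`:
`((5 + α(K₄))c − 6κ(a))·(ω − 2) ≤ 4(1 − α(K₄))`. [cite: ChristandlVranaZuiddam2016, §2.1 (nonuniformsymm)] -/
theorem rungPrice_symm_tetraAlpha {c a : ℝ} (hB : 4 + c * (omega F - 2) ≤ omegaTetra F) (ha0 : 0 ≤ a)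
    (ha : a ≤ 1 / 2) (hα : a ≤ dualExponentAlpha F) :
    ((5 + tetraAlpha F) * c - 6 * ((1 - 2 * a) / (1 - a))) * (omega F - 2) ≤ 4 * (1 - tetraAlpha F) :=
  rungPrice_symm F (tetraAlpha_nonneg F) (tetraAlpha_le_one F) (omegaSix_tetraAlpha F).le hB ha0 ha hα

/-- The linear price at `δ = α(K₄)`: `(c − κ(a))·(ω − 2) ≤ 1 − α(K₄)`. [cite: LottiRomani1983, §3] -/
theorem rungPrice_linear_tetraAlpha {c a : ℝ} (hB : 4 + c * (omega F - 2) ≤ omegaTetra F) (ha0 : 0 ≤ a)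
    (ha : a ≤ 1 / 2) (hα : a ≤ dualExponentAlpha F) :
    (c - (1 - 2 * a) / (1 - a)) * (omega F - 2) ≤ 1 - tetraAlpha F :=
  rungPrice_linear F (tetraAlpha_le_one F) (omegaSix_tetraAlpha F).le hB ha0 ha hα

/-- **The price on the tree floor** (`α > 0.1722`, Coppersmith 1982, PROVED in the tree; `6κ < 4.752`):
a rung at `δ` and `B_c` give `((5+δ)c − 4.752)·(ω − 2) ≤ 4(1 − δ)`.
[cite: Coppersmith1982, Thm. 1] -/
theorem rungPrice_symm_floor {δ c : ℝ} (hδ0 : 0 ≤ δ) (hδ1 : δ ≤ 1)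
    (hr : omegaSix F δ ≤ omegaRect F 2 1 2) (hB : 4 + c * (omega F - 2) ≤ omegaTetra F) :
    ((5 + δ) * c - 4.752) * (omega F - 2) ≤ 4 * (1 - δ) := by
  have h := rungPrice_symm F hδ0 hδ1 hr hB (by norm_num) (by norm_num)
    (coppersmithFloor_le_dualExponentAlpha F)
  have hκ := kappa_coppersmithFloor_lt
  have hd := defect_nonneg F
  nlinarith [mul_le_mul_of_nonneg_right hκ.le hd]

/-- Linear form on the floor: `(c − 0.792)·(ω − 2) ≤ 1 − δ`. [cite: Coppersmith1982, Thm. 1] -/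
theorem rungPrice_linear_floor {δ c : ℝ} (hδ1 : δ ≤ 1) (hr : omegaSix F δ ≤ omegaRect F 2 1 2)
    (hB : 4 + c * (omega F - 2) ≤ omegaTetra F) :
    (c - 0.792) * (omega F - 2) ≤ 1 - δ := by
  have h := rungPrice_linear F hδ1 hr hB (by norm_num) (by norm_num)
    (coppersmithFloor_le_dualExponentAlpha F)
  have hκ := kappa_coppersmithFloor_lt
  have hd := defect_nonneg F
  nlinarith [mul_le_mul_of_nonneg_right hκ.le hd]

/-- **The price on the record** (`α ≥ 0.3213` as a hypothesis; `6κ(0.3213) < 3.1602`): a rung at `δ` and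
`B_c` give `((5+δ)c − 3.1602)·(ω − 2) ≤ 4(1 − δ)`. [cite: VassilevskaWilliamsXuXuZhou2024, Thm. 1.2] -/
theorem rungPrice_symm_record (hα : (0.3213 : ℝ) ≤ dualExponentAlpha F) {δ c : ℝ} (hδ0 : 0 ≤ δ)
    (hδ1 : δ ≤ 1) (hr : omegaSix F δ ≤ omegaRect F 2 1 2) (hB : 4 + c * (omega F - 2) ≤ omegaTetra F) :
    ((5 + δ) * c - 3.1602) * (omega F - 2) ≤ 4 * (1 - δ) := by
  have h := rungPrice_symm F hδ0 hδ1 hr hB (by norm_num) (by norm_num) hα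
  have hκ : (1 - 2 * (0.3213 : ℝ)) / (1 - 0.3213) < 0.5267 := by
    rw [div_lt_iff₀ (by norm_num)]
    norm_num
  have hd := defect_nonneg F
  nlinarith [mul_le_mul_of_nonneg_right hκ.le hd]

/-- **Converse reading**: in a world with the residual `B_c` (`c > κ`) and `ω > 2`, the flat part of the
ladder stops short of `1`: `α(K₄) ≤ 1 − (c − κ(a))(ω − 2)` and `α(K₄) ≤ 1 − ((5+α(K₄))c − 6κ(a))(ω−2)/4`.
[cite: LottiRomani1983, §3] -/
theorem tetraAlpha_le_of_transferGE {c a : ℝ} (hB : 4 + c * (omega F - 2) ≤ omegaTetra F) (ha0 : 0 ≤ a)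
    (ha : a ≤ 1 / 2) (hα : a ≤ dualExponentAlpha F) :
    tetraAlpha F ≤ 1 - (c - (1 - 2 * a) / (1 - a)) * (omega F - 2) := by
  linarith [rungPrice_linear_tetraAlpha F hB ha0 ha hα]

end Price

/-! ## §2 Over `ℂ`, by name: the residual `TetraPlusTwo` and the rungs of `α(K₄)` -/

section Complex

/-- `TetraPlusTwo` as the residual notch `B_1 : 4 + 1·(ω − 2) ≤ ω(K₄)`. -/
theorem residual_of_tetraPlusTwo (hB : TetraPlusTwo) : 4 + 1 * (omega ℂ - 2) ≤ omegaTetra ℂ := by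
  have := hB; unfold TetraPlusTwo at this; linarith

/-- **`TetraPlusTwo → rung at δ → (0.248 + δ)(ω − 2) ≤ 4(1 − δ)`** (floor price, `c = 1`).
[cite: Coppersmith1982, Thm. 1] -/
theorem omega_price_of_rung_of_tetraPlusTwo (hB : TetraPlusTwo) {δ : ℝ} (hδ0 : 0 ≤ δ) (hδ1 : δ ≤ 1)
    (hr : omegaSix ℂ δ ≤ omegaRect ℂ 2 1 2) : (0.248 + δ) * (omega ℂ - 2) ≤ 4 * (1 - δ) := by
  have h := rungPrice_symm_floor ℂ hδ0 hδ1 hr (residual_of_tetraPlusTwo hB)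
  nlinarith [defect_nonneg ℂ]

/-- **`TetraPlusTwo → a ≤ α(K₄) → (0.248 + a)(ω − 2) ≤ 4(1 − a)`** for `0 ≤ a`: every certified lower
bound on the tetrahedral dual exponent is worth this much toward `ω = 2`, and exactly `ω = 2` at `a = 1`.
[cite: Coppersmith1982, Thm. 1] -/
theorem omega_price_of_le_tetraAlpha (hB : TetraPlusTwo) {a : ℝ} (ha0 : 0 ≤ a) (ha : a ≤ tetraAlpha ℂ) :
    (0.248 + a) * (omega ℂ - 2) ≤ 4 * (1 - a) :=
  omega_price_of_rung_of_tetraPlusTwo hB ha0 (ha.trans (tetraAlpha_le_one ℂ))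
    (sixRung_of_le_tetraAlpha ℂ ha)

/-- The price at `α(K₄)` itself: `TetraPlusTwo → (0.248 + α(K₄))(ω − 2) ≤ 4(1 − α(K₄))`.
[cite: Coppersmith1982, Thm. 1] -/
theorem omega_price_tetraAlpha (hB : TetraPlusTwo) :
    (0.248 + tetraAlpha ℂ) * (omega ℂ - 2) ≤ 4 * (1 - tetraAlpha ℂ) :=
  omega_price_of_le_tetraAlpha hB (tetraAlpha_nonneg ℂ) le_rfl

/-- **Stability of the cut**: `TetraPlusTwo → 1 − ε ≤ α(K₄) → (1.248 − ε)(ω − 2) ≤ 4ε` — an `ε`-short leaf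
plus the residual bounds the defect linearly in `ε` (`closes` is `ε = 0`). [cite: Coppersmith1982, Thm. 1] -/
theorem omega_stable_of_tetraAlpha_ge (hB : TetraPlusTwo) {ε : ℝ} (hε : ε ≤ 1)
    (h : 1 - ε ≤ tetraAlpha ℂ) : (1.248 - ε) * (omega ℂ - 2) ≤ 4 * ε := by
  have h' := omega_price_of_le_tetraAlpha hB (by linarith) h
  nlinarith [defect_nonneg ℂ]

/-- **Converse: the residual and `ω > 2` keep `α(K₄)` away from `1`**:
`TetraPlusTwo → α(K₄) ≤ 1 − 0.208(ω − 2)` (floor, linear form) — in an `ω > 2` world where the residual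
holds, the leaf fails quantitatively. [cite: Coppersmith1982, Thm. 1] -/
theorem tetraAlpha_le_of_tetraPlusTwo (hB : TetraPlusTwo) :
    tetraAlpha ℂ ≤ 1 - 0.208 * (omega ℂ - 2) := by
  have h := rungPrice_linear_floor ℂ (tetraAlpha_le_one ℂ) (omegaSix_tetraAlpha ℂ).le
    (residual_of_tetraPlusTwo hB)
  nlinarith [defect_nonneg ℂ]

/-- **On the record** (`α ≥ 0.3213` as a hypothesis): `TetraPlusTwo → rung at δ →
(1.8398 + δ)(ω − 2) ≤ 4(1 − δ)`. [cite: VassilevskaWilliamsXuXuZhou2024, Thm. 1.2] -/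
theorem omega_price_of_rung_record (hα : (0.3213 : ℝ) ≤ dualExponentAlpha ℂ) (hB : TetraPlusTwo)
    {δ : ℝ} (hδ0 : 0 ≤ δ) (hδ1 : δ ≤ 1) (hr : omegaSix ℂ δ ≤ omegaRect ℂ 2 1 2) :
    (1.8398 + δ) * (omega ℂ - 2) ≤ 4 * (1 - δ) := by
  have h := rungPrice_symm_record ℂ hα hδ0 hδ1 hr (residual_of_tetraPlusTwo hB)
  nlinarith [defect_nonneg ℂ]

/-- **NEWS THRESHOLD**: on the record, a rung at `δ ≥ 0.76` together with the residual beats the printed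
`ω ≤ 2.371552` (`4·0.24/2.5998 < 0.3693`); §3 shows that below `δ ≈ 0.7587` it cannot.
[cite: VassilevskaWilliamsXuXuZhou2024, Thm. 1.2] -/
theorem omega_lt_of_rung_record (hα : (0.3213 : ℝ) ≤ dualExponentAlpha ℂ) (hB : TetraPlusTwo)
    {δ : ℝ} (hδ : 0.76 ≤ δ) (hδ1 : δ ≤ 1) (hr : omegaSix ℂ δ ≤ omegaRect ℂ 2 1 2) :
    omega ℂ < 2.3694 := by
  have h := omega_price_of_rung_record hα hB (by linarith) hδ1 hr
  nlinarith [defect_nonneg ℂ]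

/-- NEC: under `ω = 2` every price is paid (`α(K₄) = 1`, `tetraAlpha_eq_one_of_matrixMultiplication`) and
the residual holds (`EdgePencilDefectCuts.plusTwo_of_matrixMultiplication`); recorded for the cone lint. -/
theorem price_context_of_matrixMultiplication (hS : _root_.MatrixMultiplication) :
    tetraAlpha ℂ = 1 ∧ TetraPlusTwo :=
  (matrixMultiplication_iff_tetraAlpha_eq_one_and_tetraPlusTwo).1 hS

end Complex

/-! ## §3 The price is exact: symmetrisation-tight worlds with the residual and a rung at every `a < 1` -/

namespace SixWorld

/-- **The symmetrisation-tight world with defect `d ∈ [0, 2]`**: `ω = 2 + d`, `ψ = 4 + 0.5267d` (record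
chord, tight), `T = ω + 2` (residual `B_1`, tight), `χ(δ) = max(ψ, (5+δ)T/6)` (symmetrisation law, tight
on the rising part). Its flat part is `[0, a]` with `(1.8398 + a)d = 4(1 − a)`. -/
def symmWorld (d : ℝ) (hd0 : 0 ≤ d) (hd2 : d ≤ 2) : SixWorld where
  om := 2 + d
  psi := 4 + 0.5267 * d
  tet := 4 + d
  chi := fun δ => max (4 + 0.5267 * d) ((5 + δ) * (4 + d) / 6)
  chi_zero := by
    apply max_eq_left
    rw [div_le_iff₀ (by norm_num : (0 : ℝ) < 6)]
    nlinarith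
  chi_one := by
    rw [max_eq_right]
    · ring
    · rw [le_div_iff₀ (by norm_num : (0 : ℝ) < 6)]
      nlinarith
  two_le_om := by linarith
  four_le_psi := by nlinarith
  psi_le_cover := by nlinarith
  tet_le_two_mul := by linarith
  kappa := by nlinarith
  mono := fun δ δ' _ h _ => by
    refine max_le_max le_rfl ?_
    rw [div_le_div_iff_of_pos_right (by norm_num : (0 : ℝ) < 6)]
    nlinarith
  convex := by
    refine ⟨convex_Icc 0 1, fun x _ y _ p q hp hq hpq => ?_⟩
    simp only [smul_eq_mul]
    refine max_le ?_ ?_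
    · have h1 := mul_le_mul_of_nonneg_left (le_max_left (4 + 0.5267 * d) ((5 + x) * (4 + d) / 6)) hp
      have h2 := mul_le_mul_of_nonneg_left (le_max_left (4 + 0.5267 * d) ((5 + y) * (4 + d) / 6)) hq
      have : (4 + 0.5267 * d : ℝ) = p * (4 + 0.5267 * d) + q * (4 + 0.5267 * d) := by
        linear_combination (4 + 0.5267 * d : ℝ) * hpq.symm
      linarith
    · have h3 := mul_le_mul_of_nonneg_left (le_max_right (4 + 0.5267 * d) ((5 + x) * (4 + d) / 6)) hp
      have h4 := mul_le_mul_of_nonneg_left (le_max_right (4 + 0.5267 * d) ((5 + y) * (4 + d) / 6)) hq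
      have : ((5 + (p * x + q * y)) * (4 + d) / 6 : ℝ) =
          p * ((5 + x) * (4 + d) / 6) + q * ((5 + y) * (4 + d) / 6) := by
        linear_combination ((5 : ℝ) * (4 + d) / 6) * hpq.symm
      linarith
  block := fun δ h0 h1 => by
    refine max_le (by linarith) ?_
    rw [div_le_iff₀ (by norm_num : (0 : ℝ) < 6)]
    nlinarith [mul_le_mul_of_nonneg_left hd2 h0]
  top := fun δ h0 h1 => by
    have h := le_max_right (4 + 0.5267 * d) ((5 + δ) * (4 + d) / 6)
    have h' : (4 + d : ℝ) ≤ (5 + δ) * (4 + d) / 6 + (1 - δ) := by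
      rw [← sub_nonneg]
      have : (5 + δ) * (4 + d) / 6 + (1 - δ) - (4 + d) = (2 - d) * (1 - δ) / 6 := by ring
      rw [this]
      exact div_nonneg (mul_nonneg (by linarith) (by linarith)) (by norm_num)
    linarith
  symm := fun δ _ _ => by
    have h := le_max_right (4 + 0.5267 * d) ((5 + δ) * (4 + d) / 6)
    have : (6 : ℝ) * ((5 + δ) * (4 + d) / 6) = (5 + δ) * (4 + d) := by ring
    nlinarith

variable {d : ℝ} (hd0 : 0 ≤ d) (hd2 : d ≤ 2)

/-- The residual `B_1 = TetraPlusTwo` holds with equality in `symmWorld d`. -/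
theorem symmWorld_residual : (symmWorld d hd0 hd2).om + 2 = (symmWorld d hd0 hd2).tet := by
  show 2 + d + 2 = 4 + d
  ring

/-- The record chord `ψ − 4 = κ(0.3213)(ω − 2)` holds with equality in `symmWorld d`. -/
theorem symmWorld_chord : (symmWorld d hd0 hd2).psi - 4 = 0.5267 * ((symmWorld d hd0 hd2).om - 2) := by
  show 4 + 0.5267 * d - 4 = 0.5267 * (2 + d - 2)
  ring

/-- **The flat part of `symmWorld d` is exactly `{δ ≥ 0 | (1.8398 + δ)d ≤ 4(1 − δ)}`**: the rung at `δ`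
holds iff `δ` is priced in. -/
theorem symmWorld_rung_iff {δ : ℝ} :
    (symmWorld d hd0 hd2).chi δ ≤ (symmWorld d hd0 hd2).psi ↔ (1.8398 + δ) * d ≤ 4 * (1 - δ) := by
  show max (4 + 0.5267 * d) ((5 + δ) * (4 + d) / 6) ≤ 4 + 0.5267 * d ↔ _
  rw [max_le_iff, div_le_iff₀ (by norm_num : (0 : ℝ) < 6)]
  exact ⟨fun ⟨_, h⟩ => by nlinarith, fun h => ⟨le_rfl, by nlinarith⟩⟩

/-- Consistency with the rest of the recorded cone, for `d ≤ 0.371552`: the grouping law `5ω/3 ≤ ψ`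
(`TetraResidualGroupingCeiling.five_thirds_mul_omega_le_omegaRect_two_one_two`), the half-step law
`ω ≤ ω(1,1/2,1) + 1/2`, the printed `ω ≤ 2.371552` and `ω(K₄) ≤ 4.633908` all hold in `symmWorld d`.
[cite: VassilevskaWilliamsXuXuZhou2024, Thm. 1.2] [cite: BrandEtAl2026, Thm. 48] -/
theorem symmWorld_recorded (hd : d ≤ 0.371552) :
    5 / 3 * (symmWorld d hd0 hd2).om ≤ (symmWorld d hd0 hd2).psi ∧
      (symmWorld d hd0 hd2).om ≤ (symmWorld d hd0 hd2).psi / 2 + 1 / 2 ∧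
        (symmWorld d hd0 hd2).om ≤ 2.371552 ∧ (symmWorld d hd0 hd2).tet ≤ 4.633908 := by
  refine ⟨show 5 / 3 * (2 + d) ≤ 4 + 0.5267 * d by nlinarith,
    show 2 + d ≤ (4 + 0.5267 * d) / 2 + 1 / 2 by nlinarith, show 2 + d ≤ 2.371552 by linarith,
    show 4 + d ≤ 4.633908 by linarith⟩

/-- **THE PRICE IS EXACT.** For every `a ∈ [0.0534, 1]` there is a six-law world with the record chord and
the residual `TetraPlusTwo` (both tight), the rung at `a`, and `(1.8398 + a)(ω − 2) = 4(1 − a)` EXACTLY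
(the bound `omega_price_of_rung_record` attained); `ω > 2` there unless `a = 1`.
[cite: ChristandlVranaZuiddam2016, §2.1 (nonuniformsymm)] [cite: VassilevskaWilliamsXuXuZhou2024, Thm. 1.2] -/
theorem rungPrice_exact {a : ℝ} (ha0 : 0.0534 ≤ a) (ha1 : a ≤ 1) :
    ∃ W : SixWorld, W.chi a ≤ W.psi ∧ W.om + 2 = W.tet ∧ W.psi - 4 = 0.5267 * (W.om - 2) ∧
      (1.8398 + a) * (W.om - 2) = 4 * (1 - a) ∧ (a < 1 → 2 < W.om) := by
  have hK : 0 < 1.8398 + a := by linarith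
  set d : ℝ := 4 * (1 - a) / (1.8398 + a) with hd_def
  have hdK : d * (1.8398 + a) = 4 * (1 - a) := by
    rw [hd_def]
    field_simp
  have hd0 : 0 ≤ d := div_nonneg (by linarith) hK.le
  have hd2 : d ≤ 2 := by
    rw [hd_def, div_le_iff₀ hK]
    linarith
  refine ⟨symmWorld d hd0 hd2, by rw [symmWorld_rung_iff]; linarith, symmWorld_residual hd0 hd2,
    symmWorld_chord hd0 hd2, show (1.8398 + a) * (2 + d - 2) = 4 * (1 - a) by linarith, fun h => ?_⟩
  show 2 < 2 + d
  linarith [div_pos (by linarith : (0 : ℝ) < 4 * (1 - a)) hK]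

/-- **No rung short of the leaf closes the cut.** For every `0 ≤ a < 1` there is a six-law world (record
chord, residual `B_1`) in which the rung at `a` holds and `ω ≠ 2`: `closes (hA : TetraExcessZero)
(hB : TetraPlusTwo)` consumes the leaf in full — relative to the recorded laws, `α(K₄) ≥ a` with `a < 1`
and the residual do not give the summit. (Compare `sixRungPos_undecided`, whose hinge world has a rung but
violates the residual: `ω + 2 = 4.37 > 4.3 = T`.) [cite: ChristandlVranaZuiddam2016, §2.1 (nonuniformsymm)] -/
theorem rung_and_residual_not_a_cut {a : ℝ} (ha0 : 0 ≤ a) (ha1 : a < 1) :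
    ∃ W : SixWorld, W.chi a ≤ W.psi ∧ W.om + 2 ≤ W.tet ∧ W.psi - 4 ≤ 0.5267 * (W.om - 2) ∧ W.om ≠ 2 := by
  obtain ⟨W, hr, hB, hch, -, hω⟩ := rungPrice_exact (a := max a 0.0534) (le_max_right _ _)
    (max_le ha1.le (by norm_num))
  have hlt : max a 0.0534 < 1 := max_lt ha1 (by norm_num)
  refine ⟨W, ?_, hB.le, hch.le, ?_⟩
  · exact (W.mono a (max a 0.0534) ha0 (le_max_left _ _) hlt.le).trans hr
  · exact (hω hlt).ne'

/-- **Below the news threshold a rung buys nothing**: the world `symmWorld 0.371552` sits AT the printed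
record `ω = 2.371552`, obeys every recorded law (`symmWorld_recorded`), the residual and the record chord,
and has its rung at every `δ ≤ 0.7586` — so a certified `α(K₄) ≥ 0.7586` plus `TetraPlusTwo` is consistent
with no news on `ω`. [cite: VassilevskaWilliamsXuXuZhou2024, Thm. 1.2] -/
theorem rung_below_threshold_no_news :
    ∃ W : SixWorld, W.chi 0.7586 ≤ W.psi ∧ W.om + 2 = W.tet ∧ W.psi - 4 = 0.5267 * (W.om - 2) ∧
      W.om = 2.371552 ∧ 5 / 3 * W.om ≤ W.psi ∧ W.om ≤ W.psi / 2 + 1 / 2 ∧ W.tet ≤ 4.633908 := by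
  have hd0 : (0 : ℝ) ≤ 0.371552 := by norm_num
  have hd2 : (0.371552 : ℝ) ≤ 2 := by norm_num
  obtain ⟨h53, hhalf, -, hT⟩ := symmWorld_recorded hd0 hd2 le_rfl
  exact ⟨symmWorld 0.371552 hd0 hd2, by rw [symmWorld_rung_iff]; norm_num, symmWorld_residual hd0 hd2,
    symmWorld_chord hd0 hd2, show (2 : ℝ) + 0.371552 = 2.371552 by norm_num, h53, hhalf, hT⟩

/-- **The price list inside the axioms**: in EVERY six-law world, a rung at `δ`, a residual notch `B_c`
and a chord of slope `κ` give `((5+δ)c − 6κ)(ω − 2) ≤ 4(1 − δ)` — attained by the worlds above.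
[cite: ChristandlVranaZuiddam2016, §2.1 (nonuniformsymm)] -/
theorem rungPrice (W : SixWorld) {δ c κ : ℝ} (hδ0 : 0 ≤ δ) (hδ1 : δ ≤ 1) (hr : W.chi δ ≤ W.psi)
    (hB : 4 + c * (W.om - 2) ≤ W.tet) (hκ : W.psi - 4 ≤ κ * (W.om - 2)) :
    ((5 + δ) * c - 6 * κ) * (W.om - 2) ≤ 4 * (1 - δ) := by
  have hs := W.symm δ hδ0 hδ1
  have h1 : (5 + δ) * (4 + c * (W.om - 2)) ≤ (5 + δ) * W.tet :=
    mul_le_mul_of_nonneg_left hB (by linarith)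
  nlinarith

end SixWorld

end Summit.MatrixMultiplication.MatrixMultiplication.Theorems.EdgePencil
end
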